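import Mathlib.RingTheory.Polynomial.UniqueFactorization
import Mathlib.RingTheory.MvPolynomial.IrreducibleQuadratic
import Mathlib.LinearAlgebra.Matrix.ToLinearEquiv
import Mathlib.LinearAlgebra.Matrix.Adjugate
import Literature.ModelTheory.Zilber.EACProofs
import Literature.NumberTheory.Transcendental.ExpVarietiesRotundProofs
import Literature.NumberTheory.Transcendental.NesterenkoChowFormPrime
import HarnessLib

/-!
# EAC: rotundity is automatic over an aperiodic hypersurface base — the cells `(n, n - 1)` split

Part of the Exponential-Algebraic Closedness (EAC) ladder of `Literature.ModelTheory.Zilber.EAC`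
(cells `ECCell n d`; the first OPEN cell in print is `(n, d) = (3, 2)`). Sorry-free; NO new named
facts (no `def … : Prop` carrying a citation of an unproved result); definitions of elementary
notions (`transl`, `HasIntegerPeriod`, `graphBase`, `sphereBase`) and two sub-cells of `ECCell (d + 1) d`.

## 1. The theorem

Let `F` be algebraically closed of characteristic `0`, `W ⊆ Fⁿ × Fⁿ` irreducible Zariski closed,
`V = W ∩ Gⁿ ≠ ∅` (`Gⁿ = Fⁿ × (Fˣ)ⁿ`), `dim W = n`, and suppose the Zariski closure `B = cl π(V)` of
the additive projection has dimension `n - 1` — the shape of every cell `ECCell n (n - 1)`, in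
particular of the first open one `ECCell 3 2`. Then `B = Z(h)` is an irreducible HYPERSURFACE
(`exists_irreducible_vanishingIdeal_eq_span`: a prime of `F[X₁, …, Xₙ]` of dimension `n - 1` is
principal — `dim` drops under every proper prime quotient of an affine domain). Call `B`
*periodic* if it is invariant under the translation `x ↦ x + v` by some nonzero INTEGER vector
`v ∈ ℤⁿ` (`HasIntegerPeriod`; equivalently `h(X + v) = h(X)`, equivalently `B` is a cylinder
`B = B + F·v` in the rational direction `v`, `hasIntegerPeriod_iff_forall_mem_zeroLocus`).

**Theorem** (`isRotund_of_not_hasIntegerPeriod`). If `B` is NOT periodic then `V` is rotund: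
`rk M ≤ dim [M] V` for every `M ∈ Mₙ(ℤ)` (`Literature.NumberTheory.Transcendental.IsRotund`,
Bays–Kirby's matrix form of Zilber's ex-normality).

Proof. Let `ξ = (ξₓ, ξ_y)` be a generic point of `W` over `F` (`Literature.genericPt`), so that
`dim [M] V = trdeg_F F[[M] ξ]` (`Literature.zariskiDim_image_matrixAct_eq`, Bays–Kirby 2018, proof
of Prop. 7.3) and the ideal of `ξₓ` over `F` is `I(B) = (h)`.
* `det M ≠ 0`: every coordinate of `ξ` is algebraic over `F[[M] ξ]` — `ξₓ = (det M)⁻¹ adj(M)·(M ξₓ)`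
  and `ξ_{y,j} ^ (det M)² = ∏ₖ (ξ_y^M)ₖ ^ (det M · adj(M)_{jk})` (`isAlgebraic_of_det_ne_zero`) — so
  `trdeg F[[M] ξ] ≥ trdeg F[ξ] = dim W = n ≥ rk M`.
* `det M = 0`: pick `v ∈ ℤⁿ ∖ 0` with `M v = 0` and `r = rk M` rows `M_{e k}` with an integer dual
  family (`exists_int_dual_family`). The `r` linear forms `Lₖ = ∑ⱼ M_{e k, j} ξₓⱼ` — coordinates
  of `[M] ξ` — are ALGEBRAICALLY INDEPENDENT over `F` (`algebraicIndependent_linForm_of_aperiodic`):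
  if `p(L) = 0` with `p ≠ 0` then `P₀ = p(M_e X) ∈ I(B) = (h)` is a nonzero polynomial (the dual
  family inverts `X ↦ M_e X` on the left, `aeval_linForm_injective`) invariant under `X ↦ X + t v`
  (`M_e v = 0`); hence every translate `h(X + m v)`, `m ∈ ℕ`, is an irreducible divisor of `P₀`;
  two of them are associated only if `(h)` is invariant under a nonzero integer translation
  `(m' - m) v` — excluded — so `P₀` would have infinitely many pairwise non-associated irreducible
  factors (pigeonhole on `UniqueFactorizationMonoid.factors P₀`). Hence `dim [M] V ≥ r`.

For `n = 2` (`B` a plane curve) aperiodicity says exactly that `B` is not a translate of a line of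
rational slope — the hypothesis "`π(S)` is not a coset of a rational line" under which
Mantova–Masser 2024 Thm. 1.2 find infinitely many exponential points; Aslanyan–Gallinaro 2024,
Def. 3.3 and §3.2 (2)–(3), phrase rotundity through the projections `π_Q`, `Q ≤ ℂⁿ` a
`ℚ`-subspace: for a hypersurface base, `dim π_Q(V) ≥ n - dim Q` fails iff `B + Q = B`. We know no
printed statement of the theorem for general `n`; it is an elementary consequence of these
definitions, recorded here because it removes the rotundity hypothesis from "most" of the open
cell (§2).

## 2. Consequence for the ladder: `ECCell (d + 1) d` splits into an aperiodic and a periodic sub-cell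

* `ECCellAperiodic d`: every irreducible `W ⊆ ℂⁿ × ℂⁿ`, `n = d + 1`, with `W ∩ Gⁿ ≠ ∅`, `dim W = n`,
  `dim cl π(V) = d`, `V` additively and multiplicatively free and `cl π(V)` NOT periodic, meets the
  graph of `exp` — NO ROTUNDITY HYPOTHESIS;
* `ECCellPeriodic d`: the cell `ECCell (d + 1) d` restricted to periodic bases (rotundity kept).

`ecCell_succ_iff : ECCell (d + 1) d ↔ ECCellAperiodic d ∧ ECCellPeriodic d` (by the theorem and
excluded middle); `ecCell_three_two_iff` is the case `d = 2`. So the first open rung reads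
`ECCell 3 2 ↔ ECCellAperiodic 2 ∧ ECCellPeriodic 2`, and on the aperiodic side — which contains
Mantova–Masser's model system `x₃ = x₁² - x₂²`: the quadric has no integer period
(`not_hasIntegerPeriod_mmBase`, three test points) — rotundity is a CONSEQUENCE of the other
hypotheses, not an extra constraint: there the open problem is "free ⇒ exponential point". On the
periodic side (`B = C + ℂ·v` a cylinder over a `(d - 1)`-dimensional variety in a rational
direction `v`, e.g. `x₃ = (x₁ - x₂)²` with `v = (1, 1, 0)`, `hasIntegerPeriod_diagSquareBase`)
rotundity is a genuine restriction. Additive freeness is implied by aperiodicity for `n ≥ 2`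
(`isAddFree_of_not_hasIntegerPeriod`: a constant integer form would make the base the affine
hyperplane `∑ mᵢ xᵢ = c`, which has integer periods), so `ECCellAperiodic` could drop it; we keep
the printed list of hypotheses minus rotundity.

## 3. Cylinders, and deciding periodicity for the bases in use

* `forall_transl_smul_mem_of_period` (char. `0`): an integer period `v` of `I(S)` gives invariance
  under `X ↦ X + t v` for EVERY scalar `t` (the polynomial `t ↦ p(x + t v)` has infinitely many
  roots), so a periodic base is a CYLINDER `cl S + F·v ⊆ cl S`; `period_of_period_zsmul`: periods may
  be taken primitive.
* `hasIntegerPeriod_graphBase_iff`: the graph base `x_{s+1} = g(x')` (`graphBase g`) has the period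
  `(w', w_{s+1})` iff `g(X' + w') = g(X') + w_{s+1}`; for `g` quadratic: iff the symmetric matrix of
  its quadratic part has a nonzero rational kernel vector. `hasIntegerPeriod_graphBase_linear_iff`:
  a hyperplane `x_{s+1} = Σ rᵢ xᵢ + c` is periodic iff `Σ rᵢ wᵢ = w_{s+1}` has a nonzero integer
  solution (`hasIntegerPeriod_sqrtTwoHyperplane`: `x₃ = √2 x₁ - x₂` is periodic, `v = (0, 1, -1)`).
* `not_hasIntegerPeriod_sphereBase`: complex spheres `Σ xᵢ² = r` (`n ≥ 2`, any `r`) are aperiodic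
  (`x ↦ -x` symmetry forces `Σ vᵢ² = 0`), so irreducible `n`-folds of dimension `n` over a sphere base
  — a non-graph base — are automatically rotund and additively free.

## What is NOT here

* No case of `ECCell 3 2` / `ECCellAperiodic 2` / `ECCellPeriodic 2` is proved: all three are OPEN
  (Mantova–Masser 2024 §1; Aslanyan–Gallinaro 2024 §3.4–3.5). Nothing here bears on Schanuel's
  conjecture (EAC is a different statement and does not imply SC).
* The converse "periodic base ⇒ not rotund" is false in general (rotundity may come from the
  multiplicative coordinates) and is not claimed.
* Bases of dimension `< n - 1` (cells `(n, d)`, `d ≤ n - 2`): aperiodicity does NOT give rotundity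
  there; nothing is claimed.

Sources: Bays–Kirby, *Pseudo-exponential maps, variants, and quasiminimality* (BaysKirby2018ANT,
arXiv:1512.04262) Def. 7.1 and proof of Prop. 7.3 (generic-point computation of `dim [M] V`);
Aslanyan–Gallinaro 2024 (arXiv:2409.12860) Def. 3.3, §3.2; Mantova–Masser 2024 (MantovaMasser2023,
arXiv:2303.05592) Thm. 1.2 and §1 p. 5 (model system); Zilber 2005 §3; Matsumura, *Commutative
Ring Theory*, Thm. 5.6 (`dim = trdeg`). Definitions used: `ExpVarieties` (`IsRotund`, `matrixAct`,
`torusLocus`, `zariskiDim`, `IsAddFree`), `ExpVarietiesDimension` (`genericPt`, `IsGenericPt`),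
`EAC` (`ECCell`, `addProjDim`, `projAdd`). The example bases (`mmBase`, `diagSquareBase`,
`sqrtTwoHyperplane`, `sphereBase`) are the additive projections of the model systems of
Mantova–Masser 2024 §1 p. 5 and of the tree files `Summits/Schanuel/Schanuel/Theorems/ZilberEacComplex*`
(seat 2 of this lane); no statement of those files is used or restated here.
-/

noncomputable section

open MvPolynomial

universe u

namespace Literature.ModelTheory.Zilber

open Literature.NumberTheory.Transcendental

/-! ### Translations of affine space acting on polynomials -/

section Transl

variable {F : Type*} [Field F] {ι : Type*}

/-- **Translation of polynomials** by a vector `w ∈ F^ι`: `(transl w p)(x) = p(x + w)`, the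
`F`-algebra endomorphism `Xᵢ ↦ Xᵢ + wᵢ` of `F[X_ι]`. [folklore] -/
def transl (w : ι → F) : MvPolynomial ι F →ₐ[F] MvPolynomial ι F :=
  aeval fun i => X i + C (w i)

/-- `transl w (Xᵢ) = Xᵢ + wᵢ`. [folklore] -/
@[simp] theorem transl_X (w : ι → F) (i : ι) : transl w (X i : MvPolynomial ι F) = X i + C (w i) := by
  simp [transl]

/-- Translations fix constants. [folklore] -/
@[simp] theorem transl_C (w : ι → F) (a : F) : transl w (C a : MvPolynomial ι F) = C a := by
  simp [transl]

/-- `(transl w p)(x) = p(x + w)` for points with values in any `F`-algebra. [folklore] -/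
theorem aeval_transl {E : Type*} [CommRing E] [Algebra F E] (w : ι → F) (x : ι → E)
    (p : MvPolynomial ι F) :
    aeval x (transl w p) = aeval (fun i => x i + algebraMap F E (w i)) p := by
  rw [transl, ← AlgHom.comp_apply, comp_aeval]
  have hfun : (fun i => aeval x (X i + C (w i) : MvPolynomial ι F)) =
      fun i => x i + algebraMap F E (w i) := by
    funext i
    simp
  rw [hfun]

/-- `(transl w p)(x) = p(x + w)`. [folklore] -/
theorem eval_transl (w x : ι → F) (p : MvPolynomial ι F) :
    eval x (transl w p) = eval (x + w) p := by
  -- `aeval = eval` and `algebraMap F F = id`, definitionally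
  exact aeval_transl (E := F) w x p

/-- Translating by `0` is the identity. [folklore] -/
theorem transl_zero : transl (0 : ι → F) = AlgHom.id F (MvPolynomial ι F) := by
  refine MvPolynomial.algHom_ext fun i => ?_
  simp

/-- `transl (a + b) = transl a ∘ transl b`. [folklore] -/
theorem transl_add (a b : ι → F) : transl (a + b) = (transl a).comp (transl b) := by
  refine MvPolynomial.algHom_ext fun i => ?_
  simp only [transl_X, AlgHom.comp_apply, map_add, transl_C, Pi.add_apply]
  ring

/-- Translation by `w` as an `F`-algebra automorphism of `F[X_ι]` (inverse: translation by `-w`).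
[folklore] -/
def translEquiv (w : ι → F) : MvPolynomial ι F ≃ₐ[F] MvPolynomial ι F :=
  AlgEquiv.ofAlgHom (transl w) (transl (-w))
    (by rw [← transl_add, add_neg_cancel, transl_zero])
    (by rw [← transl_add, neg_add_cancel, transl_zero])

/-- `translEquiv w` acts as `transl w`. [folklore] -/
@[simp] theorem translEquiv_apply (w : ι → F) (p : MvPolynomial ι F) :
    translEquiv w p = transl w p := rfl

/-- Translates of an irreducible polynomial are irreducible. [folklore] -/
theorem irreducible_transl {w : ι → F} {p : MvPolynomial ι F} (hp : Irreducible p) :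
    Irreducible (transl w p) := by
  rw [← translEquiv_apply]
  exact hp.map (translEquiv w)

/-- `transl (m • w) ∘ transl (m' • w) = transl ((m + m') • w)` read on integer multiples: the
translates `transl (m • w)`, `m ∈ ℤ`, form a one-parameter group. [folklore] -/
theorem transl_zsmul_add (w : ι → F) (m m' : ℤ) :
    transl ((m + m') • w) = (transl (m • w)).comp (transl (m' • w)) := by
  rw [add_zsmul, transl_add]

variable (F) in
/-- **Integer period.** The Zariski closure of `S ⊆ Fⁿ` is invariant under the translation
`x ↦ x + v` by the nonzero integer vector `v ∈ ℤⁿ`: its vanishing ideal is stable under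
`p ↦ p(X + v)`. For the closure `B` of the additive projection of a variety in a cell
`ECCell n (n - 1)` (`B = Z(h)` a hypersurface) this says `h(X + v) = c·h(X)`, i.e. `B` is a cylinder
in the rational direction `v`. [folklore] -/
def HasIntegerPeriod {n : ℕ} (S : Set (Fin n → F)) : Prop :=
  ∃ v : Fin n → ℤ, v ≠ 0 ∧
    ∀ p ∈ vanishingIdeal F S, transl (fun i => (v i : F)) p ∈ vanishingIdeal F S

/-- **Point reading of a period**: `I(S)` is stable under `p ↦ p(X + w)` iff the Zariski closure
`Z(I(S))` of `S` is mapped into itself by `x ↦ x + w`. [folklore] -/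
theorem forall_transl_mem_vanishingIdeal_iff {n : ℕ} (S : Set (Fin n → F)) (w : Fin n → F) :
    (∀ p ∈ vanishingIdeal F S, transl w p ∈ vanishingIdeal F S) ↔
      ∀ x ∈ zeroLocus F (vanishingIdeal F S), x + w ∈ zeroLocus F (vanishingIdeal F S) := by
  constructor
  · intro h x hx
    rw [mem_zeroLocus_iff] at hx ⊢
    intro p hp
    have := hx _ (h p hp)
    rwa [aeval_transl] at this
  · intro h p hp
    rw [mem_vanishingIdeal_iff]
    intro x hx
    have hx' : x ∈ zeroLocus F (vanishingIdeal F S) := by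
      rw [mem_zeroLocus_iff]
      exact fun q hq => (mem_vanishingIdeal_iff.1 hq) x hx
    have := (mem_zeroLocus_iff.1 (h x hx')) p hp
    rw [aeval_transl]
    exact this

/-- `HasIntegerPeriod F S` iff the Zariski closure of `S` is invariant under translation by some
nonzero integer vector. [folklore] -/
theorem hasIntegerPeriod_iff_forall_mem_zeroLocus {n : ℕ} (S : Set (Fin n → F)) :
    HasIntegerPeriod F S ↔ ∃ v : Fin n → ℤ, v ≠ 0 ∧
      ∀ x ∈ zeroLocus F (vanishingIdeal F S),
        (x + fun i => (v i : F)) ∈ zeroLocus F (vanishingIdeal F S) := by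
  simp only [HasIntegerPeriod, forall_transl_mem_vanishingIdeal_iff]

end Transl

/-! ### Closed sets: two membership lemmas -/

section Closed

/-- Points of the zero locus of a principal ideal. [folklore] -/
theorem mem_zeroLocus_span_singleton_iff {K : Type*} [Field K] {ι : Type*} (f : MvPolynomial ι K)
    (x : ι → K) : x ∈ zeroLocus K (Ideal.span {f}) ↔ aeval x f = 0 := by
  rw [mem_zeroLocus_iff]
  constructor
  · exact fun h => h f (Ideal.mem_span_singleton_self f)
  · intro h p hp
    obtain ⟨c, rfl⟩ := Ideal.mem_span_singleton'.1 hp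
    rw [map_mul, h, mul_zero]

/-- A Zariski closed set is the zero locus of its vanishing ideal, membership form. [folklore] -/
theorem mem_zeroLocus_vanishingIdeal_iff_of_isZariskiClosed {K : Type*} [Field K] {ι : Type*}
    {S : Set (ι → K)} (hS : IsZariskiClosed K S) (x : ι → K) :
    x ∈ zeroLocus K (vanishingIdeal K S) ↔ x ∈ S := by
  rw [← eq_zeroLocus_vanishingIdeal_of_isZariskiClosed hS]

end Closed

/-! ### An integer period makes the closure a cylinder in a rational direction -/

section Cylinder

variable {F : Type*} [Field F] [CharZero F] {n : ℕ}

omit [CharZero F] in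
/-- Iterating a period: `x + m v` stays in the closure for all `m ∈ ℕ`. [folklore] -/
theorem add_nsmul_mem_zeroLocus_of_period {S : Set (Fin n → F)} {v : Fin n → F}
    (h : ∀ x ∈ zeroLocus F (vanishingIdeal F S), x + v ∈ zeroLocus F (vanishingIdeal F S))
    {x : Fin n → F} (hx : x ∈ zeroLocus F (vanishingIdeal F S)) (m : ℕ) :
    x + m • v ∈ zeroLocus F (vanishingIdeal F S) := by
  induction m with
  | zero => simpa using hx
  | succ m ih =>
    rw [succ_nsmul, ← add_assoc]
    exact h _ ih

/-- **Period ⇒ cylinder.** If `I(S)` is stable under `p ↦ p(X + v)` then it is stable under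
`p ↦ p(X + t v)` for EVERY scalar `t` (characteristic `0`): for `x` in the closure and `p ∈ I(S)`
the one-variable polynomial `t ↦ p(x + t v)` vanishes at every `t ∈ ℕ`, hence identically. So a
periodic hypersurface `B` satisfies `B + F·v = B`. [folklore] -/
theorem forall_transl_smul_mem_of_period {S : Set (Fin n → F)} {v : Fin n → F}
    (hper : ∀ p ∈ vanishingIdeal F S, transl v p ∈ vanishingIdeal F S) (t : F) :
    ∀ p ∈ vanishingIdeal F S, transl (t • v) p ∈ vanishingIdeal F S := by
  rw [forall_transl_mem_vanishingIdeal_iff] at hper ⊢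
  intro x hx
  rw [mem_zeroLocus_iff]
  intro p hp
  -- the one-variable polynomial `q(T) = p(x + T v)`
  let q : Polynomial F :=
    aeval (fun i => Polynomial.C (x i) + Polynomial.C (v i) * Polynomial.X) p
  have hq : ∀ s : F, q.eval s = aeval (x + s • v) p := by
    intro s
    have hfun : (fun i => Polynomial.aeval s (Polynomial.C (x i) + Polynomial.C (v i) * Polynomial.X))
        = x + s • v := by
      funext i
      simp only [map_add, map_mul, Polynomial.aeval_C, Polynomial.aeval_X,
        Algebra.algebraMap_self_apply, Pi.add_apply, Pi.smul_apply, smul_eq_mul]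
      ring
    rw [← hfun, ← comp_aeval, AlgHom.comp_apply, Polynomial.coe_aeval_eq_eval]
  have hroots : ∀ m : ℕ, q.IsRoot (m : F) := by
    intro m
    rw [Polynomial.IsRoot.def, hq, Nat.cast_smul_eq_nsmul]
    exact (mem_zeroLocus_iff.1 (add_nsmul_mem_zeroLocus_of_period hper hx m)) p hp
  have hq0 : q = 0 :=
    Polynomial.eq_zero_of_infinite_isRoot q
      (Set.infinite_of_injective_forall_mem Nat.cast_injective hroots)
  have ht := hq t
  rw [hq0, Polynomial.eval_zero] at ht
  exact ht.symm

/-- The line through a period: an integer period `v` of `I(S)` makes the closure of `S` invariant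
under the whole line `F·v`. [folklore] -/
theorem exists_forall_add_smul_mem_of_hasIntegerPeriod {S : Set (Fin n → F)}
    (h : HasIntegerPeriod F S) :
    ∃ v : Fin n → ℤ, v ≠ 0 ∧ ∀ t : F, ∀ x ∈ zeroLocus F (vanishingIdeal F S),
      (x + t • fun i => (v i : F)) ∈ zeroLocus F (vanishingIdeal F S) := by
  obtain ⟨v, hv, hper⟩ := h
  refine ⟨v, hv, fun t => ?_⟩
  exact (forall_transl_mem_vanishingIdeal_iff S _).1 (forall_transl_smul_mem_of_period hper t)

/-- **Periods may be taken primitive**: a period `k v` (`k ∈ ℤ ∖ 0`) gives the period `v`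
(translate by `t = 1/k` along the cylinder). [folklore] -/
theorem period_of_period_zsmul {S : Set (Fin n → F)} {v : Fin n → ℤ} {k : ℤ} (hk : k ≠ 0)
    (h : ∀ p ∈ vanishingIdeal F S, transl (fun i => ((k • v) i : F)) p ∈ vanishingIdeal F S) :
    ∀ p ∈ vanishingIdeal F S, transl (fun i => (v i : F)) p ∈ vanishingIdeal F S := by
  have key := forall_transl_smul_mem_of_period h (k : F)⁻¹
  have hfun : ((k : F)⁻¹ • fun i => (((k • v) i : ℤ) : F)) = fun i => (v i : F) := by
    funext i
    have hk' : (k : F) ≠ 0 := by exact_mod_cast hk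
    simp only [Pi.smul_apply, Int.cast_mul, smul_eq_mul]
    field_simp
  rwa [hfun] at key

end Cylinder

/-! ### Graph bases `x_{s+1} = g(x')`: the periodicity criterion -/

section GraphBase

variable {F : Type*} [Field F] {s : ℕ}

/-- The graph base `B_g = {x ∈ F^{s+1} : x_{s+1} = g(x₁, …, x_s)}` of a polynomial `g` — the
closure of the additive projection of all of seat 2's graph-base families
(`decoupledGraph`, `fibredGraph`, `polyFibredGraph` of `EACRotundityProofs`). [folklore] -/
def graphBase (g : MvPolynomial (Fin s) F) : Set (Fin (s + 1) → F) :=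
  {x | x (Fin.last s) = eval (fun i => x (Fin.castSucc i)) g}

/-- `B_g = Z(X_{s+1} - g(X'))`. [folklore] -/
theorem graphBase_eq_zeroLocus (g : MvPolynomial (Fin s) F) :
    graphBase g = zeroLocus F (Ideal.span {(X (Fin.last s) - rename Fin.castSucc g :
      MvPolynomial (Fin (s + 1)) F)}) := by
  ext x
  simp only [graphBase, Set.mem_setOf_eq, mem_zeroLocus_span_singleton_iff, map_sub, aeval_X,
    aeval_rename, sub_eq_zero, Function.comp_def]
  exact Iff.rfl

/-- Graph bases are Zariski closed. [folklore] -/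
theorem isZariskiClosed_graphBase (g : MvPolynomial (Fin s) F) : IsZariskiClosed F (graphBase g) :=
  ⟨_, graphBase_eq_zeroLocus g⟩

/-- **Periodicity criterion for graph bases.** `B_g` has the integer period `w = (w', w_{s+1})`
iff `g(X' + w') = g(X') + w_{s+1}` as polynomials; e.g. for `g = Q + ℓ + c` quadratic, iff `w'`
is a (rational) kernel vector of the symmetric matrix of `Q` and `w_{s+1} = ℓ(w')`. So
`x₃ = x₁² - x₂²` and `x₃ = (x₁ - √2 x₂)²` are aperiodic, `x₃ = (x₁ - x₂)²` is periodic. [folklore] -/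
theorem hasIntegerPeriod_graphBase_iff [Infinite F] (g : MvPolynomial (Fin s) F) :
    HasIntegerPeriod F (graphBase g) ↔ ∃ w : Fin (s + 1) → ℤ, w ≠ 0 ∧
      transl (fun i => (w (Fin.castSucc i) : F)) g = g + C (w (Fin.last s) : F) := by
  rw [hasIntegerPeriod_iff_forall_mem_zeroLocus]
  refine exists_congr fun w => and_congr_right fun _ => ?_
  simp only [mem_zeroLocus_vanishingIdeal_iff_of_isZariskiClosed (isZariskiClosed_graphBase g)]
  simp only [graphBase, Set.mem_setOf_eq, Pi.add_apply]
  constructor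
  · intro h
    apply MvPolynomial.funext
    intro x'
    rw [eval_transl, map_add, eval_C]
    have hx := h (Fin.snoc x' (eval x' g)) (by simp)
    simp only [Fin.snoc_last, Fin.snoc_castSucc] at hx
    rw [hx, show (x' + fun i => (w (Fin.castSucc i) : F)) =
      fun i => x' i + (w (Fin.castSucc i) : F) from rfl]
  · intro h x hx
    have key := congrArg (eval fun i => x (Fin.castSucc i)) h
    rw [eval_transl, map_add, eval_C, ← hx] at key
    rw [show (fun i => x (Fin.castSucc i) + (w (Fin.castSucc i) : F)) =
      (fun i => x (Fin.castSucc i)) + fun i => (w (Fin.castSucc i) : F) from rfl]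
    exact key.symm


/-- **Hyperplane bases.** `B = {x_{s+1} = Σ rᵢ xᵢ + c}` has an integer period iff
`Σ rᵢ wᵢ = w_{s+1}` has a solution `w ∈ ℤ^{s+1} ∖ 0`, i.e. iff `r₁, …, r_s, -1` are `ℚ`-linearly
dependent (e.g. some `rᵢ ∈ ℚ`, or two `rᵢ` with rational ratio); such `B` is additively free iff
`r ∉ ℚˢ`. So seat 2's real-hyperplane family (`ZilberEacComplexRealHyperplane`) lives in BOTH
sub-cells, according to `r`. [folklore] -/
theorem hasIntegerPeriod_graphBase_linear_iff [CharZero F] (r : Fin s → F) (c : F) :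
    HasIntegerPeriod F (graphBase (∑ i, C (r i) * X i + C c)) ↔
      ∃ w : Fin (s + 1) → ℤ, w ≠ 0 ∧
        ∑ i, r i * (w (Fin.castSucc i) : F) = (w (Fin.last s) : F) := by
  haveI : Infinite F := Infinite.of_injective _ Nat.cast_injective
  rw [hasIntegerPeriod_graphBase_iff]
  refine exists_congr fun w => and_congr_right fun _ => ?_
  have hlin : transl (fun i => (w (Fin.castSucc i) : F)) (∑ i, C (r i) * X i + C c) =
      (∑ i, C (r i) * X i + C c) + C (∑ i, r i * (w (Fin.castSucc i) : F)) := by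
    simp only [map_add, map_sum, map_mul, transl_C, transl_X, mul_add, Finset.sum_add_distrib]
    ring
  rw [hlin, add_right_inj, C_inj]

/-- Seat 2's model base `x₃ = √2 x₁ - x₂` (`sqrt_two_hyperplane_model_system_solvable`) is
PERIODIC, with period `(0, 1, -1)`: its varieties belong to the periodic sub-cell `ECCellPeriodic 2`
(there rotundity is a genuine hypothesis, supplied by the multiplicative side). [folklore] -/
theorem hasIntegerPeriod_sqrtTwoHyperplane :
    HasIntegerPeriod ℂ (graphBase (C (Real.sqrt 2 : ℂ) * X 0 - X 1 : MvPolynomial (Fin 2) ℂ)) := by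
  refine (hasIntegerPeriod_graphBase_iff _).2 ⟨![0, 1, -1], fun h => by simpa using congrFun h 1, ?_⟩
  have h0 : ((![0, 1, -1] : Fin 3 → ℤ) (Fin.castSucc 0) : ℂ) = 0 := by
    simp [show (Fin.castSucc (0 : Fin 2) : Fin 3) = 0 from rfl]
  have h1 : ((![0, 1, -1] : Fin 3 → ℤ) (Fin.castSucc 1) : ℂ) = 1 := by
    simp [show (Fin.castSucc (1 : Fin 2) : Fin 3) = 1 from rfl]
  have h2 : ((![0, 1, -1] : Fin 3 → ℤ) (Fin.last 2) : ℂ) = -1 := by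
    simp [show (Fin.last 2 : Fin 3) = 2 from rfl]
  simp only [map_sub, map_mul, transl_C, transl_X, h0, h1, h2, map_zero, add_zero, map_neg, map_one]
  ring

end GraphBase

/-! ### A prime of `F[X₁, …, X_{d+1}]` of dimension `d` is principal -/

section Principal

variable {F : Type u} [Field F] {d : ℕ}

/-- **Hypersurfaces**: if `S ⊆ F^{d+1}` has prime vanishing ideal and Zariski dimension `d`, then
`I(S) = (h)` for an irreducible polynomial `h` (a height-one prime of the UFD `F[X]` is principal:
take an irreducible factor `h ∈ I(S)` of any nonzero element; if `(h) ⊊ I(S)` then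
`dim F[X]/I(S) ≤ dim F[X]/(h) - 1 ≤ d - 1`). [folklore] -/
theorem exists_irreducible_vanishingIdeal_eq_span {S : Set (Fin (d + 1) → F)}
    (hS : (vanishingIdeal F S).IsPrime) (hdim : zariskiDim F S = d) :
    ∃ h : MvPolynomial (Fin (d + 1)) F, Irreducible h ∧ vanishingIdeal F S = Ideal.span {h} := by
  classical
  set 𝔞 := vanishingIdeal F S with h𝔞
  have hR : ringKrullDim (MvPolynomial (Fin (d + 1)) F) = (d + 1 : ℕ) := by
    rw [MvPolynomial.ringKrullDim_of_isNoetherianRing, ringKrullDim_eq_zero_of_field,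
      Nat.card_eq_fintype_card, Fintype.card_fin, zero_add]
  -- `𝔞 ≠ ⊥`
  have hbot : 𝔞 ≠ ⊥ := by
    intro hb
    have : zariskiDim F S = (d + 1 : ℕ) := by
      rw [zariskiDim, ← h𝔞, hb, ringKrullDim_eq_of_ringEquiv (RingEquiv.quotientBot _), hR]
    rw [hdim] at this
    have : (d : ℕ) = d + 1 := by exact_mod_cast this
    omega
  obtain ⟨f, hf𝔞, hf0⟩ := Submodule.exists_mem_ne_zero_of_ne_bot hbot
  have hfu : ¬ IsUnit f := fun hu => hS.ne_top (Ideal.eq_top_of_isUnit_mem _ hf𝔞 hu)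
  -- an irreducible factor of `f` lies in `𝔞`
  have hprod : (UniqueFactorizationMonoid.factors f).prod ∈ 𝔞 := by
    obtain ⟨c, hc⟩ := (UniqueFactorizationMonoid.factors_prod hf0).symm.dvd
    rw [hc]
    exact Ideal.mul_mem_right _ _ hf𝔞
  obtain ⟨h, hhf, hh𝔞⟩ := (hS.multiset_prod_mem_iff_exists_mem _).1 hprod
  have hirr : Irreducible h := UniqueFactorizationMonoid.irreducible_of_factor _ hhf
  refine ⟨h, hirr, ?_⟩
  have hle : Ideal.span {h} ≤ 𝔞 := (Ideal.span_singleton_le_iff_mem _).2 hh𝔞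
  have hh0 : h ≠ 0 := hirr.ne_zero
  haveI hprime : (Ideal.span ({h} : Set (MvPolynomial (Fin (d + 1)) F))).IsPrime :=
    (Ideal.span_singleton_prime hh0).2 (UniqueFactorizationMonoid.irreducible_iff_prime.1 hirr)
  by_contra hne
  have hlt : Ideal.span {h} < 𝔞 := lt_of_le_of_ne hle (Ne.symm hne)
  -- the quotient `A = F[X]/(h)` and the image `𝔭` of `𝔞` in it
  set A := MvPolynomial (Fin (d + 1)) F ⧸ Ideal.span ({h} : Set (MvPolynomial (Fin (d + 1)) F))
  haveI : IsDomain A := Ideal.Quotient.isDomain _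
  set 𝔭 : Ideal A := 𝔞.map (Ideal.Quotient.mk (Ideal.span {h})) with h𝔭
  have h𝔭0 : 𝔭 ≠ ⊥ := by
    obtain ⟨g, hg𝔞, hgh⟩ := SetLike.exists_of_lt hlt
    intro hb
    have hg : Ideal.Quotient.mk (Ideal.span {h}) g ∈ 𝔭 := Ideal.mem_map_of_mem _ hg𝔞
    rw [hb, Ideal.mem_bot, Ideal.Quotient.eq_zero_iff_mem] at hg
    exact hgh hg
  have h1 := Literature.RingTheory.KrullDimension.ringKrullDim_quotient_add_one_le h𝔭0
  have h2 := Literature.RingTheory.KrullDimension.ringKrullDim_quotient_add_one_le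
    (A := MvPolynomial (Fin (d + 1)) F) (𝔭 := Ideal.span {h}) (by rwa [Ne, Ideal.span_singleton_eq_bot])
  have h3 : ringKrullDim (A ⧸ 𝔭) = d := by
    rw [ringKrullDim_eq_of_ringEquiv (DoubleQuot.quotQuotEquivQuotOfLE hle)]
    exact hdim
  rw [h3] at h1
  rw [hR] at h2
  -- `d + 1 ≤ dim A` and `dim A + 1 ≤ d + 1`
  have h4 : (d : WithBot ℕ∞) + 1 + 1 ≤ (d + 1 : ℕ) := (add_le_add h1 le_rfl).trans h2
  have h5 : ((d + 2 : ℕ) : WithBot ℕ∞) ≤ ((d + 1 : ℕ) : WithBot ℕ∞) := by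
    have : ((d + 2 : ℕ) : WithBot ℕ∞) = (d : WithBot ℕ∞) + 1 + 1 := by push_cast; ring
    rwa [this]
  have : d + 2 ≤ d + 1 := by exact_mod_cast h5
  omega

end Principal

/-! ### Linear forms along an integer dual family -/

section LinForm

variable (F : Type*) [Field F] {ι κ : Type*} [Fintype ι]

/-- The linear forms `ℓₖ = ∑ⱼ R_{k j} Xⱼ ∈ F[X_ι]` with integer coefficient rows `R k ∈ ℤ^ι`
(the rows `M_{e k}` of an integer matrix along a dual family). [folklore] -/
def linForm (R : κ → ι → ℤ) (k : κ) : MvPolynomial ι F :=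
  ∑ j, C ((R k j : ℤ) : F) * X j

variable {F}

/-- `ℓₖ(x) = ∑ⱼ R_{kj} xⱼ`. [folklore] -/
theorem aeval_linForm {E : Type*} [CommRing E] [Algebra F E] (R : κ → ι → ℤ) (k : κ) (x : ι → E) :
    aeval x (linForm F R k) = ∑ j, (R k j : E) * x j := by
  simp [linForm, map_sum]

/-- `ℓₖ(X + w) = ℓₖ(X) + ℓₖ(w)`. [folklore] -/
theorem transl_linForm (R : κ → ι → ℤ) (k : κ) (w : ι → F) :
    transl w (linForm F R k) = linForm F R k + C (∑ j, (R k j : F) * w j) := by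
  simp only [linForm, map_sum, map_mul, transl_C, transl_X, mul_add, Finset.sum_add_distrib]

/-- **The substitution `X ↦ (ℓₖ)ₖ` is injective** when the rows `R k` admit an integer dual family
`q` with `∑ⱼ R_{kj} q_{lj} = d δ_{kl}`, `d ≥ 1` (characteristic `0`): `Xⱼ ↦ d⁻¹ ∑ₗ q_{lj} Xₗ` is a
left inverse. [folklore] -/
theorem aeval_linForm_injective [CharZero F] [Fintype κ] (R q : κ → ι → ℤ) {d : ℕ}
    (hd : 0 < d) (hRq : ∀ k, ∑ j, R k j * q k j = d)
    (hRq0 : ∀ k l, k ≠ l → ∑ j, R k j * q l j = 0) :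
    Function.Injective (aeval (linForm F R) : MvPolynomial κ F →ₐ[F] MvPolynomial ι F) := by
  classical
  -- the left inverse
  let ψ : MvPolynomial ι F →ₐ[F] MvPolynomial κ F :=
    aeval fun j => C ((d : F)⁻¹) * ∑ l, C ((q l j : ℤ) : F) * X l
  have hd0 : (d : F) ≠ 0 := by exact_mod_cast hd.ne'
  have key : ∀ k l, (∑ j, ((R k j : ℤ) : F) * ((q l j : ℤ) : F)) = if k = l then (d : F) else 0 := by
    intro k l
    have : (∑ j, ((R k j : ℤ) : F) * ((q l j : ℤ) : F)) = ((∑ j, R k j * q l j : ℤ) : F) := by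
      push_cast; rfl
    rw [this]
    split_ifs with hkl
    · subst hkl; rw [hRq]; push_cast; rfl
    · rw [hRq0 k l hkl]; push_cast; rfl
  have hψ : ∀ k, ψ (linForm F R k) = X k := by
    intro k
    simp only [linForm, map_sum, map_mul, ψ, aeval_C, aeval_X, algebraMap_eq]
    calc ∑ j, C ((R k j : ℤ) : F) * (C ((d : F)⁻¹) * ∑ l, C ((q l j : ℤ) : F) * X l)
        = C ((d : F)⁻¹) * ∑ l, (∑ j, C (((R k j : ℤ) : F) * ((q l j : ℤ) : F))) * X l := by
          simp only [Finset.mul_sum, Finset.sum_mul, C_mul]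
          rw [Finset.sum_comm]
          refine Finset.sum_congr rfl fun l _ => Finset.sum_congr rfl fun j _ => ?_
          ring
      _ = C ((d : F)⁻¹) * ∑ l, C (if k = l then (d : F) else 0) * X l := by
          congr 1
          refine Finset.sum_congr rfl fun l _ => ?_
          rw [← map_sum, key]
      _ = X k := by
          simp only [apply_ite C, map_zero, ite_mul, zero_mul, Finset.sum_ite_eq, Finset.mem_univ,
            if_true, ← mul_assoc, ← C_mul, inv_mul_cancel₀ hd0, C_1, one_mul]
  have hcomp : ψ.comp (aeval (linForm F R)) = AlgHom.id F _ := by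
    refine MvPolynomial.algHom_ext fun k => ?_
    simp only [AlgHom.comp_apply, aeval_X, AlgHom.id_apply, hψ]
  intro p p' hpp'
  have := congrArg ψ hpp'
  rwa [← AlgHom.comp_apply, ← AlgHom.comp_apply, hcomp] at this

end LinForm

/-! ### Algebraic independence of linear forms at a point whose ideal is an aperiodic hypersurface -/

section Independence

variable {F : Type*} [Field F] [CharZero F] {E : Type*} [Field E] [Algebra F E]
  {ι κ : Type*} [Fintype ι] [Fintype κ]

/-- **Linear forms along dual rows are algebraically independent at a generic point of an
aperiodic hypersurface.** Let `x ∈ E^ι` have ideal `(h)` over `F`, `h` irreducible, such that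
`(h)` is stable under NO translation by a nonzero integer vector. Let `R k` (`k ∈ κ`) be integer rows
with an integer dual family and a common nonzero integer kernel vector `v` (`∑ⱼ R_{kj} vⱼ = 0`).
Then the values `∑ⱼ R_{kj} xⱼ` are algebraically independent over `F`: a relation `p` gives the
nonzero polynomial `P₀ = p(ℓ) ∈ (h)`, invariant under `X ↦ X + m v`; all translates `h(X + m v)`
(`m ∈ ℕ`) are irreducible divisors of `P₀`, pairwise non-associated (else `(h)` has the integer
period `(m' - m) v`), contradicting finiteness of the factorisation of `P₀`. [folklore] -/
theorem algebraicIndependent_linForm_of_aperiodic {x : ι → E} {h : MvPolynomial ι F}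
    (hirr : Irreducible h) (hker : ∀ p : MvPolynomial ι F, aeval x p = 0 ↔ p ∈ Ideal.span {h})
    (haper : ∀ w : ι → ℤ, w ≠ 0 →
      ∃ p ∈ Ideal.span ({h} : Set (MvPolynomial ι F)), transl (fun i => (w i : F)) p ∉ Ideal.span ({h} : Set (MvPolynomial ι F)))
    (R q : κ → ι → ℤ) {d : ℕ} (hd : 0 < d) (hRq : ∀ k, ∑ j, R k j * q k j = d)
    (hRq0 : ∀ k l, k ≠ l → ∑ j, R k j * q l j = 0) {v : ι → ℤ} (hv : v ≠ 0)
    (hRv : ∀ k, ∑ j, R k j * v j = 0) :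
    AlgebraicIndependent F fun k => ∑ j, (R k j : E) * x j := by
  classical
  rw [algebraicIndependent_iff]
  intro p hp
  by_contra hp0
  -- `P₀ = p(ℓ) ∈ (h)` is nonzero
  set P₀ : MvPolynomial ι F := aeval (linForm F R) p with hP₀
  have hP₀mem : P₀ ∈ Ideal.span ({h} : Set (MvPolynomial ι F)) := by
    rw [← hker, hP₀, ← AlgHom.comp_apply, comp_aeval]
    have : (fun k => aeval x (linForm F R k)) = fun k => ∑ j, (R k j : E) * x j :=
      funext fun k => aeval_linForm R k x
    rw [this]
    exact hp
  have hP₀0 : P₀ ≠ 0 := fun h0 =>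
    hp0 (aeval_linForm_injective R q hd hRq hRq0 (by rw [← hP₀, h0, map_zero]))
  -- `P₀` is invariant under the translations `X ↦ X + m v`
  let w : ℤ → ι → F := fun m i => ((m * v i : ℤ) : F)
  have hw : ∀ m, w m = m • fun i => ((v i : ℤ) : F) := by
    intro m; funext i; simp [w, zsmul_eq_mul]
  have hinv : ∀ m : ℤ, transl (w m) P₀ = P₀ := by
    intro m
    rw [hP₀, ← AlgHom.comp_apply, comp_aeval]
    have hfun : (fun k => transl (w m) (linForm F R k)) = linForm F R := by
      funext k
      rw [transl_linForm]
      have : (∑ j, (R k j : F) * w m j) = 0 := by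
        have h0 := hRv k
        have : (∑ j, (R k j : F) * w m j) = ((m * ∑ j, R k j * v j : ℤ) : F) := by
          push_cast [w, Finset.mul_sum]
          exact Finset.sum_congr rfl fun j _ => by ring
        rw [this, h0, mul_zero, Int.cast_zero]
      rw [this, C_0, add_zero]
    rw [hfun]
  -- the translates of `h`
  let hm : ℤ → MvPolynomial ι F := fun m => transl (w m) h
  have hm_irr : ∀ m, Irreducible (hm m) := fun m => irreducible_transl hirr
  have hm_dvd : ∀ m, hm m ∣ P₀ := by
    intro m
    obtain ⟨c, hc⟩ := Ideal.mem_span_singleton.1 hP₀mem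
    refine ⟨transl (w m) c, ?_⟩
    rw [← map_mul, ← hc, hinv]
  -- two translates are associated only if `(h)` has an integer period
  have hm_assoc : ∀ m m' : ℤ, Associated (hm m) (hm m') → m = m' := by
    intro m m' hass
    by_contra hne
    -- translate back by `-m`: `h ~ transl ((m' - m) v) h`
    have hass' : Associated h (transl (w (m' - m)) h) := by
      have e1 : transl (w (-m)) (hm m) = h := by
        show transl (w (-m)) (transl (w m) h) = h
        rw [← AlgHom.comp_apply, hw, hw, ← transl_zsmul_add, neg_add_cancel, zero_zsmul,
          transl_zero, AlgHom.id_apply]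
      have e2 : transl (w (-m)) (hm m') = transl (w (m' - m)) h := by
        show transl (w (-m)) (transl (w m') h) = _
        rw [← AlgHom.comp_apply, hw, hw, hw, ← transl_zsmul_add, neg_add_eq_sub]
      have := hass.map (transl (w (-m)))
      rwa [e1, e2] at this
    obtain ⟨u, hu⟩ := hass'
    have hper : ∀ p' ∈ Ideal.span ({h} : Set (MvPolynomial ι F)),
        transl (fun i => (((m' - m) * v i : ℤ) : F)) p' ∈ Ideal.span ({h} : Set (MvPolynomial ι F)) := by
      intro p' hp'
      obtain ⟨c, hc⟩ := Ideal.mem_span_singleton.1 hp'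
      rw [Ideal.mem_span_singleton]
      refine ⟨↑u * transl (w (m' - m)) c, ?_⟩
      rw [hc, map_mul]
      show transl (w (m' - m)) h * _ = _
      rw [← hu]
      ring
    obtain ⟨p', hp'mem, hp'not⟩ := haper (fun i => (m' - m) * v i) (by
      obtain ⟨i, hi⟩ := Function.ne_iff.1 hv
      refine Function.ne_iff.2 ⟨i, ?_⟩
      exact mul_ne_zero (sub_ne_zero.2 (Ne.symm hne) |> fun h => by
        intro h'; exact h (by linarith [h'])) hi)
    exact hp'not (hper p' hp'mem)
  -- pigeonhole on the finite multiset of irreducible factors of `P₀`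
  have hfac : ∀ m : ℤ, ∃ g ∈ UniqueFactorizationMonoid.factors P₀, Associated (hm m) g :=
    fun m => UniqueFactorizationMonoid.exists_mem_factors_of_dvd hP₀0 (hm_irr m) (hm_dvd m)
  choose g hg hga using hfac
  let f : ℤ → (UniqueFactorizationMonoid.factors P₀).toFinset :=
    fun m => ⟨g m, Multiset.mem_toFinset.2 (hg m)⟩
  obtain ⟨m, m', hne, hfm⟩ := Finite.exists_ne_map_eq_of_infinite f
  have hgg : g m = g m' := congrArg Subtype.val hfm
  have : Associated (hm m) (hm m') := (hga m).trans (by rw [hgg]; exact (hga m').symm)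
  exact hne (hm_assoc m m' this)

end Independence

/-! ### Full-rank matrices: every coordinate of `ξ` is algebraic over `F[[M] ξ]` -/

section FullRank

variable {F : Type*} [Field F] {E : Type*} [Field E] [Algebra F E] {n : ℕ}

/-- `x ^ D · b = a` with `a, b ∈ A₀`, `b ≠ 0`, `D ≥ 1` makes `x` algebraic over the subalgebra `A₀`.
[folklore] -/
theorem isAlgebraic_of_pow_mul_eq {A₀ : Subalgebra F E} {x a b : E} {D : ℕ} (hD : 0 < D)
    (ha : a ∈ A₀) (hb : b ∈ A₀) (hb0 : b ≠ 0) (h : x ^ D * b = a) : IsAlgebraic A₀ x := by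
  refine ⟨Polynomial.C (⟨b, hb⟩ : A₀) * Polynomial.X ^ D - Polynomial.C ⟨a, ha⟩, ?_, ?_⟩
  · intro h0
    have := congrArg (fun p : Polynomial A₀ => p.coeff D) h0
    simp only [Polynomial.coeff_sub, Polynomial.coeff_C_mul, Polynomial.coeff_X_pow, if_true,
      mul_one, Polynomial.coeff_C, hD.ne', if_false, sub_zero, Polynomial.coeff_zero] at this
    exact hb0 (congrArg Subtype.val this)
  · rw [map_sub, map_mul, map_pow, Polynomial.aeval_C, Polynomial.aeval_C, Polynomial.aeval_X]
    show b * x ^ D - a = 0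
    rw [mul_comm, h, sub_self]

/-- **Coordinates are algebraic over `F[[M] ξ]` when `det M ≠ 0`.** For `ξ ∈ Gⁿ(E)` and
`M ∈ Mₙ(ℤ)` with `det M ≠ 0` (in `E`), every `ξᵢ` is algebraic over `F[[M] ξ]`:
`ξₓ = (det M)⁻¹ adj(M) (M ξₓ)` lies in `F[[M] ξ]`, and `ξ_{y,j} ^ (det M)² = ∏ₖ ((ξ_y)^M)ₖ ^ (det M · adj(M)_{jk})`.
[folklore] -/
theorem isAlgebraic_of_det_ne_zero {ξ : Fin n ⊕ Fin n → E} (hξ : ξ ∈ torusLocus E n)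
    (M : Matrix (Fin n) (Fin n) ℤ) (hdet : (M.det : E) ≠ 0) (i : Fin n ⊕ Fin n) :
    IsAlgebraic (Algebra.adjoin F (Set.range (matrixAct M ξ))) (ξ i) := by
  classical
  set A₀ : Subalgebra F E := Algebra.adjoin F (Set.range (matrixAct M ξ)) with hA₀
  have hgen : ∀ j, matrixAct M ξ j ∈ A₀ := fun j => Algebra.subset_adjoin ⟨j, rfl⟩
  -- `adj(M) M = det M`
  have hadj : ∀ j i : Fin n, (∑ k, (M.adjugate j k : ℤ) * M k i) = if j = i then M.det else 0 := by
    intro j i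
    have := congrFun (congrFun (Matrix.adjugate_mul M) j) i
    rw [Matrix.mul_apply, Matrix.smul_apply, Matrix.one_apply, smul_eq_mul, mul_ite, mul_one,
      mul_zero] at this
    exact this
  have hm0 : ∀ k, matrixAct M ξ (Sum.inr k) ≠ 0 := fun k => matrixAct_mem_torusLocus M hξ k
  have hξ0 : ∀ i, ξ (Sum.inr i) ≠ 0 := hξ
  cases i with
  | inl j =>
    -- `ξₓⱼ = det⁻¹ ∑ₖ adj_{jk} (M ξₓ)ₖ ∈ A₀`
    have hmem : ξ (Sum.inl j) ∈ A₀ := by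
      have step : ∀ i : Fin n, (∑ k, ((M.adjugate j k : ℤ) : E) * ((M k i : ℤ) : E)) =
          if j = i then (M.det : E) else 0 := by
        intro i
        have := congrArg (Int.cast : ℤ → E) (hadj j i)
        simpa only [Int.cast_sum, Int.cast_mul, Int.cast_ite, Int.cast_zero] using this
      have hsum : (∑ k, ((M.adjugate j k : ℤ) : E) * matrixAct M ξ (Sum.inl k)) =
          (M.det : E) * ξ (Sum.inl j) := by
        calc (∑ k, ((M.adjugate j k : ℤ) : E) * matrixAct M ξ (Sum.inl k))
            = ∑ k, ∑ i, ((M.adjugate j k : ℤ) : E) * (((M k i : ℤ) : E) * ξ (Sum.inl i)) := by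
              simp only [matrixAct_inl, Finset.mul_sum]
          _ = ∑ i, (∑ k, ((M.adjugate j k : ℤ) : E) * ((M k i : ℤ) : E)) * ξ (Sum.inl i) := by
              rw [Finset.sum_comm]
              simp only [Finset.sum_mul, mul_assoc]
          _ = ∑ i, (if j = i then (M.det : E) else 0) * ξ (Sum.inl i) := by simp only [step]
          _ = (M.det : E) * ξ (Sum.inl j) := by
              simp only [ite_mul, zero_mul, Finset.sum_ite_eq, Finset.mem_univ, if_true]
      have hx : ξ (Sum.inl j) = algebraMap F E ((M.det : F)⁻¹) *
          ∑ k, algebraMap F E ((M.adjugate j k : ℤ) : F) * matrixAct M ξ (Sum.inl k) := by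
        simp only [map_inv₀, map_intCast]
        rw [hsum, ← mul_assoc, inv_mul_cancel₀ hdet, one_mul]
      rw [hx]
      exact A₀.mul_mem (A₀.algebraMap_mem _)
        (A₀.sum_mem fun k _ => A₀.mul_mem (A₀.algebraMap_mem _) (hgen _))
    exact isAlgebraic_algebraMap (⟨ξ (Sum.inl j), hmem⟩ : A₀)
  | inr j =>
    -- `D = (det M)²`, exponents `B_{jk} = det M · adj(M)_{jk}` with `∑ₖ B_{jk} M_{ki} = D δ_{ji}`
    set D : ℕ := M.det.natAbs * M.det.natAbs with hD
    have hDz : (D : ℤ) = M.det * M.det := by rw [hD]; exact Int.natAbs_mul_self' _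
    have hdet0 : M.det ≠ 0 := by
      rintro h0
      exact hdet (by rw [h0, Int.cast_zero])
    have hDpos : 0 < D := Nat.mul_pos (Int.natAbs_pos.2 hdet0) (Int.natAbs_pos.2 hdet0)
    have hBM : ∀ i, (∑ k, (M.det * M.adjugate j k) * M k i) = if j = i then (D : ℤ) else 0 := by
      intro i
      have : (∑ k, (M.det * M.adjugate j k) * M k i) = M.det * ∑ k, M.adjugate j k * M k i := by
        rw [Finset.mul_sum]
        exact Finset.sum_congr rfl fun k _ => by ring
      rw [this, hadj j i, hDz]
      split_ifs <;> ring
    -- `ξ_{y j} ^ D = ∏ₖ ((ξ_y)^M)ₖ ^ B_{jk}`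
    have hpow : ξ (Sum.inr j) ^ D = ∏ k, matrixAct M ξ (Sum.inr k) ^ (M.det * M.adjugate j k) := by
      simp only [matrixAct_inr]
      rw [prod_prod_zpow_eq (fun i => hξ0 i) (fun i k => M k i) (fun k => M.det * M.adjugate j k)]
      have hite : ∀ i, ξ (Sum.inr i) ^ (∑ k, (M.det * M.adjugate j k) * M k i) =
          if j = i then ξ (Sum.inr i) ^ (D : ℤ) else 1 := by
        intro i
        rw [hBM i]
        split_ifs <;> simp
      simp only [hite, Finset.prod_ite_eq, Finset.mem_univ, if_true, zpow_natCast]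
    -- two elements of `A₀`: `b = ∏ₖ mₖ ^ |B_{jk}|` and `ξ_{y j} ^ D · b = ∏ₖ mₖ ^ (B_{jk} + |B_{jk}|)`
    set b : E := ∏ k, matrixAct M ξ (Sum.inr k) ^ (M.det * M.adjugate j k).natAbs with hb
    have hbmem : b ∈ A₀ := A₀.prod_mem fun k _ => A₀.pow_mem (hgen _) _
    have hb0 : b ≠ 0 := Finset.prod_ne_zero_iff.2 fun k _ => pow_ne_zero _ (hm0 k)
    have hab : ξ (Sum.inr j) ^ D * b ∈ A₀ := by
      rw [hpow, hb, ← Finset.prod_mul_distrib]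
      refine A₀.prod_mem fun k _ => ?_
      have hnn : 0 ≤ M.det * M.adjugate j k + ((M.det * M.adjugate j k).natAbs : ℤ) := by
        rw [Int.natCast_natAbs]
        linarith [neg_abs_le (M.det * M.adjugate j k)]
      rw [← zpow_natCast (matrixAct M ξ (Sum.inr k)) (M.det * M.adjugate j k).natAbs,
        ← zpow_add₀ (hm0 k), ← Int.toNat_of_nonneg hnn, zpow_natCast]
      exact A₀.pow_mem (hgen _) _
    exact isAlgebraic_of_pow_mul_eq hDpos hab hbmem hb0 rfl

end FullRank

/-! ### The theorem: aperiodic hypersurface base ⇒ rotund -/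

section Main

variable {F : Type u} [Field F] [IsAlgClosed F] [CharZero F] {d : ℕ}

/-- **Rotundity is automatic over an aperiodic hypersurface base** (ideal form). Let `P` be a prime
of `F[X, Y]` (`F` algebraically closed, characteristic `0`, `n = d + 1` variables of each sort) with
`Z(P) ∩ Gⁿ ≠ ∅`, `dim Z(P) = n` and `dim cl π(Z(P) ∩ Gⁿ) = n - 1`. If the closure of the additive
projection has no integer period then `Z(P) ∩ Gⁿ` is rotund: `rk M ≤ dim [M](Z(P) ∩ Gⁿ)` for all
`M ∈ Mₙ(ℤ)`. (`det M ≠ 0`: `trdeg F[[M] ξ] = trdeg F[ξ] = n`; `det M = 0`: `rk M` algebraically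
independent linear forms among the coordinates of `[M] ξ`, `ξ` a generic point.) [folklore] -/
theorem isRotund_zeroLocus_of_not_hasIntegerPeriod
    (P : Ideal (MvPolynomial (Fin (d + 1) ⊕ Fin (d + 1)) F)) [P.IsPrime]
    (hne : (zeroLocus F P ∩ torusLocus F (d + 1)).Nonempty)
    (hdim : zariskiDim F (zeroLocus F P) = (d + 1 : ℕ))
    (hbase : zariskiDim F (projAdd '' (zeroLocus F P ∩ torusLocus F (d + 1))) = d)
    (haper : ¬ HasIntegerPeriod F (projAdd '' (zeroLocus F P ∩ torusLocus F (d + 1)))) :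
    IsRotund F (d + 1) (zeroLocus F P ∩ torusLocus F (d + 1)) := by
  classical
  have hξ : IsGenericPt P (genericPt P) := isGenericPt_genericPt P
  have hIV : vanishingIdeal F (zeroLocus F P ∩ torusLocus F (d + 1)) = P :=
    vanishingIdeal_zeroLocus_inter_torusLocus P hne
  have hξT : genericPt P ∈ torusLocus (zeroLocusFunctionField P) (d + 1) :=
    genericPt_mem_torusLocus P (X_inr_notMem_of_nonempty P hne)
  intro M
  by_cases hdet : M.det = 0
  · -- sub-maximal rank: `rk M` independent linear forms
    obtain ⟨v, hv, hMv⟩ := Matrix.exists_mulVec_eq_zero_iff.2 hdet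
    obtain ⟨κ, hκ, e, q, d', hd', hcard, hMq, hMq0⟩ := exists_int_dual_family M
    have hprime : (vanishingIdeal F (projAdd '' (zeroLocus F P ∩ torusLocus F (d + 1)))).IsPrime := by
      rw [vanishingIdeal_image_projAdd, hIV]
      infer_instance
    obtain ⟨h, hirr, hspan⟩ := exists_irreducible_vanishingIdeal_eq_span hprime hbase
    have hker : ∀ p : MvPolynomial (Fin (d + 1)) F,
        aeval (fun j => genericPt P (Sum.inl j)) p = 0 ↔ p ∈ Ideal.span {h} := by
      intro p
      rw [← hspan, mem_vanishingIdeal_image_projAdd_iff, hIV, ← hξ (rename Sum.inl p), aeval_rename]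
      rfl
    have haper' : ∀ w : Fin (d + 1) → ℤ, w ≠ 0 →
        ∃ p ∈ Ideal.span ({h} : Set (MvPolynomial (Fin (d + 1)) F)),
          transl (fun i => (w i : F)) p ∉ Ideal.span ({h} : Set (MvPolynomial (Fin (d + 1)) F)) := by
      intro w hw
      by_contra hcon
      refine haper ⟨w, hw, ?_⟩
      rw [hspan]
      intro p hp
      by_contra hnot
      exact hcon ⟨p, hp, hnot⟩
    have hRv : ∀ k, ∑ j, M (e k) j * v j = 0 := fun k => by
      have := congrFun hMv (e k)
      simpa [Matrix.mulVec, dotProduct] using this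
    have hind := algebraicIndependent_linForm_of_aperiodic hirr hker haper' (fun k => M (e k)) q
      hd' hMq hMq0 hv hRv
    have hφ : vanishingIdeal F (matrixAct M '' (zeroLocus F P ∩ torusLocus F (d + 1))) ≤
        RingHom.ker (aeval (matrixAct M (genericPt P)) :
          MvPolynomial (Fin (d + 1) ⊕ Fin (d + 1)) F →ₐ[F] zeroLocusFunctionField P) :=
      (vanishingIdeal_image_matrixAct_eq_ker P hξ hne M).le
    have hg : AlgebraicIndependent F fun k => aeval (matrixAct M (genericPt P))
        (X (Sum.inl (e k)) : MvPolynomial (Fin (d + 1) ⊕ Fin (d + 1)) F) := by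
      simpa only [aeval_X, matrixAct_inl] using hind
    have := le_zariskiDim_of_algebraicIndependent _ _ hφ (fun k => X (Sum.inl (e k))) hg
    rwa [hcard] at this
  · -- full rank: `dim [M] V = dim V = d + 1 ≥ rk M`
    have hdetE : ((M.det : ℤ) : zeroLocusFunctionField P) ≠ 0 := by
      rw [← map_intCast (algebraMap F (zeroLocusFunctionField P))]
      refine (map_ne_zero_iff _ (algebraMap F (zeroLocusFunctionField P)).injective).2 ?_
      exact_mod_cast hdet
    have hrk : (((M.map (Int.cast : ℤ → ℚ)).rank : ℕ) : WithBot ℕ∞) ≤ ((d + 1 : ℕ) : WithBot ℕ∞) := by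
      exact_mod_cast (M.map (Int.cast : ℤ → ℚ)).rank_le_width
    refine hrk.trans ?_
    have h1 : zariskiDim F (matrixAct (1 : Matrix (Fin (d + 1)) (Fin (d + 1)) ℤ) ''
        (zeroLocus F P ∩ torusLocus F (d + 1))) = zariskiDim F (zeroLocus F P) := by
      have himg : matrixAct (1 : Matrix (Fin (d + 1)) (Fin (d + 1)) ℤ) ''
          (zeroLocus F P ∩ torusLocus F (d + 1)) = zeroLocus F P ∩ torusLocus F (d + 1) := by
        ext z
        simp only [Set.mem_image, matrixAct_one, exists_eq_right]
      rw [himg, zariskiDim, zariskiDim, hIV, MvPolynomial.IsPrime.vanishingIdeal_zeroLocus (K := F) P]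
    rw [zariskiDim_image_matrixAct_eq P hξ hne 1, hdim, matrixAct_one] at h1
    rw [zariskiDim_image_matrixAct_eq P hξ hne M, ← h1]
    have hle : Algebra.trdeg F (aeval (genericPt P) :
          MvPolynomial (Fin (d + 1) ⊕ Fin (d + 1)) F →ₐ[F] zeroLocusFunctionField P).range ≤
        Algebra.trdeg F (aeval (matrixAct M (genericPt P)) :
          MvPolynomial (Fin (d + 1) ⊕ Fin (d + 1)) F →ₐ[F] zeroLocusFunctionField P).range := by
      rw [← Algebra.adjoin_range_eq_range_aeval, ← Algebra.adjoin_range_eq_range_aeval]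
      exact Literature.RingTheory.NoetherNormalization.trdeg_adjoin_le_trdeg_adjoin_of_forall_isAlgebraic
        (by
          rintro _ ⟨i, rfl⟩
          exact isAlgebraic_of_det_ne_zero hξT M hdetE i)
    have hfin : Algebra.trdeg F (aeval (matrixAct M (genericPt P)) :
          MvPolynomial (Fin (d + 1) ⊕ Fin (d + 1)) F →ₐ[F] zeroLocusFunctionField P).range <
        Cardinal.aleph0 := by
      haveI : Algebra.FiniteType F (aeval (matrixAct M (genericPt P)) :
          MvPolynomial (Fin (d + 1) ⊕ Fin (d + 1)) F →ₐ[F] zeroLocusFunctionField P).range :=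
        Algebra.FiniteType.of_surjective (aeval (matrixAct M (genericPt P))).rangeRestrict
          (AlgHom.rangeRestrict_surjective _)
      rw [Literature.RingTheory.KrullDimension.trdeg_eq_toNat F]
      exact Cardinal.natCast_lt_aleph0
    exact_mod_cast Cardinal.toNat_le_toNat hle hfin

/-- **Rotundity is automatic over an aperiodic hypersurface base.** For `W ⊆ Fⁿ × Fⁿ`
(`n = d + 1`, `F` algebraically closed of characteristic `0`) irreducible Zariski closed with
`V = W ∩ Gⁿ ≠ ∅`, `dim W = n`, `dim cl π(V) = n - 1`, if `cl π(V)` is not invariant under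
translation by any nonzero integer vector then `V` is rotund. For `n = 2` the hypothesis reads
"`cl π(V)` is not a translate of a line of rational slope" (Mantova–Masser 2024 Thm. 1.2;
Aslanyan–Gallinaro 2024 Def. 3.3). [folklore] -/
theorem isRotund_of_not_hasIntegerPeriod {W : Set (Fin (d + 1) ⊕ Fin (d + 1) → F)}
    (hW : IsIrreducibleClosed F W) (hne : (W ∩ torusLocus F (d + 1)).Nonempty)
    (hdim : zariskiDim F W = (d + 1 : ℕ)) (hbase : addProjDim F (d + 1) W = d)
    (haper : ¬ HasIntegerPeriod F (projAdd '' (W ∩ torusLocus F (d + 1)))) :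
    IsRotund F (d + 1) (W ∩ torusLocus F (d + 1)) := by
  haveI := hW.2
  have hWP : W = zeroLocus F (vanishingIdeal F W) :=
    eq_zeroLocus_vanishingIdeal_of_isZariskiClosed hW.1
  rw [hWP] at hne hdim hbase haper ⊢
  exact isRotund_zeroLocus_of_not_hasIntegerPeriod _ hne hdim hbase haper

/-- **Aperiodic hypersurface base ⇒ additively free** (`n = d + 1 ≥ 2`). If a nonzero integer form
`∑ mᵢ xᵢ` were constant `= c` on `V`, the irreducible linear polynomial `∑ mᵢ Xᵢ - c` would
generate `I(cl π(V)) = (h)`, and `(h)` would then be invariant under every integer translation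
`w` with `∑ mᵢ wᵢ = 0`, `w ≠ 0` (these exist as `n ≥ 2`). So the additive-freeness hypothesis of
`ECCellAperiodic` is redundant for `d ≥ 1`; we keep it to stay verbatim-close to `ECCell`.
[folklore] -/
theorem isAddFree_of_not_hasIntegerPeriod {W : Set (Fin (d + 1) ⊕ Fin (d + 1) → F)}
    (hW : IsIrreducibleClosed F W) (hne : (W ∩ torusLocus F (d + 1)).Nonempty) (hd : 0 < d)
    (hbase : addProjDim F (d + 1) W = d)
    (haper : ¬ HasIntegerPeriod F (projAdd '' (W ∩ torusLocus F (d + 1)))) :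
    IsAddFree F (d + 1) (W ∩ torusLocus F (d + 1)) := by
  classical
  haveI := hW.2
  have hWP : W = zeroLocus F (vanishingIdeal F W) :=
    eq_zeroLocus_vanishingIdeal_of_isZariskiClosed hW.1
  rw [hWP] at hne hbase haper ⊢
  rintro m hm ⟨c, hc⟩
  have hIV : vanishingIdeal F (zeroLocus F (vanishingIdeal F W) ∩ torusLocus F (d + 1)) =
      vanishingIdeal F W :=
    vanishingIdeal_zeroLocus_inter_torusLocus (vanishingIdeal F W) hne
  have hprime : (vanishingIdeal F (projAdd ''
      (zeroLocus F (vanishingIdeal F W) ∩ torusLocus F (d + 1)))).IsPrime := by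
    rw [vanishingIdeal_image_projAdd, hIV]
    infer_instance
  obtain ⟨h, hirr, hspan⟩ := exists_irreducible_vanishingIdeal_eq_span hprime hbase
  -- the linear polynomial `p = ∑ mᵢ Xᵢ - c` vanishes on the base
  set p : MvPolynomial (Fin (d + 1)) F := linForm F (fun _ : Unit => m) () - C c with hp
  have hpmem : p ∈ vanishingIdeal F (projAdd ''
      (zeroLocus F (vanishingIdeal F W) ∩ torusLocus F (d + 1))) := by
    rw [mem_vanishingIdeal_iff]
    rintro _ ⟨z, hz, rfl⟩
    rw [hp, map_sub, aeval_linForm, aeval_C, Algebra.algebraMap_self_apply]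
    simp only [projAdd_apply]
    rw [hc z hz, sub_self]
  -- `p` is irreducible (total degree one, a nonzero coefficient)
  obtain ⟨i₀, hi₀⟩ := Function.ne_iff.1 hm
  have hmi₀ : ((m i₀ : ℤ) : F) ≠ 0 := by exact_mod_cast hi₀
  have hcoeff : p.coeff (Finsupp.single i₀ 1) = (m i₀ : F) := by
    rw [hp, coeff_sub, coeff_C, if_neg (Finsupp.single_ne_zero.2 one_ne_zero).symm, sub_zero]
    simp only [linForm, coeff_sum, coeff_C_mul, coeff_X, Finsupp.single_left_inj (one_ne_zero),
      mul_ite, mul_one, mul_zero, Finset.sum_ite_eq', Finset.mem_univ, if_true]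
  have hdeg : p.totalDegree = 1 := by
    apply le_antisymm
    · rw [hp]
      refine (totalDegree_sub _ _).trans (max_le ?_ (by rw [totalDegree_C]; exact zero_le_one))
      refine (totalDegree_finsetSum _ _).trans (Finset.sup_le fun j _ => ?_)
      refine (totalDegree_mul _ _).trans ?_
      rw [totalDegree_C, totalDegree_X, zero_add]
    · have hsupp : Finsupp.single i₀ 1 ∈ p.support := by
        rw [mem_support_iff, hcoeff]
        exact hmi₀
      have := le_totalDegree hsupp
      rwa [Finsupp.sum_single_index rfl] at this
  have hpirr : Irreducible p := by
    refine irreducible_of_totalDegree_eq_one hdeg fun x hx => ?_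
    have hdvd := hx (Finsupp.single i₀ 1)
    rw [hcoeff] at hdvd
    rw [isUnit_iff_ne_zero]
    rintro rfl
    exact hmi₀ (zero_dvd_iff.1 hdvd)
  -- hence `I(base) = (p)`
  have hhp : h ∣ p := by
    rw [← Ideal.mem_span_singleton, ← hspan]
    exact hpmem
  have hspan' : vanishingIdeal F (projAdd ''
      (zeroLocus F (vanishingIdeal F W) ∩ torusLocus F (d + 1))) = Ideal.span {p} := by
    rw [hspan]
    obtain ⟨u, hu⟩ := hhp
    rcases hpirr.isUnit_or_isUnit hu with hh | huu
    · exact (hirr.not_isUnit hh).elim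
    · exact Ideal.span_singleton_eq_span_singleton.2 ⟨huu.unit, by rw [IsUnit.unit_spec, hu]⟩
  -- a nonzero integer vector `w` with `∑ mᵢ wᵢ = 0` (`n ≥ 2`)
  haveI : Nontrivial (Fin (d + 1)) := Fin.nontrivial_iff_two_le.2 (by omega)
  obtain ⟨i₁, hi₁⟩ := exists_ne i₀
  let w : Fin (d + 1) → ℤ := Pi.single i₁ (m i₀) - Pi.single i₀ (m i₁)
  have hw0 : w ≠ 0 := by
    intro h0
    have := congrFun h0 i₁
    simp only [w, Pi.sub_apply, Pi.single_eq_same, Pi.single_eq_of_ne hi₁, sub_zero,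
      Pi.zero_apply] at this
    exact hi₀ this
  have hmw : ∑ j, m j * w j = 0 := by
    simp only [w, Pi.sub_apply, mul_sub, Finset.sum_sub_distrib, Pi.single_apply, mul_ite,
      mul_zero, Finset.sum_ite_eq', Finset.mem_univ, if_true]
    ring
  have hmwF : (∑ j, ((m j : ℤ) : F) * ((w j : ℤ) : F)) = 0 := by exact_mod_cast hmw
  -- `(p)` is invariant under translation by `w`: contradiction
  refine haper ⟨w, hw0, ?_⟩
  rw [hspan']
  intro p' hp'
  obtain ⟨c', rfl⟩ := Ideal.mem_span_singleton'.1 hp'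
  have htp : transl (fun i => (w i : F)) p = p := by
    rw [hp, map_sub, transl_C, transl_linForm]
    simp only [hmwF, C_0, add_zero]
  rw [map_mul, htp]
  exact Ideal.mul_mem_left _ _ (Ideal.mem_span_singleton_self p)

end Main

/-! ### The cells `(d + 1, d)` split: aperiodic bases need no rotundity hypothesis -/

section Cells

variable {d : ℕ}

/-- **EAC cell `(d + 1, d)`, aperiodic sub-cell — WITHOUT the rotundity hypothesis**: every
irreducible `W ⊆ ℂⁿ × ℂⁿ` (`n = d + 1`) with `W ∩ Gⁿ ≠ ∅`, additively and multiplicatively free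
`V = W ∩ Gⁿ`, `dim W = n`, `dim cl π(V) = d`, whose base `cl π(V)` has no integer period, meets
the graph of `exp` (rotundity of such `V` is automatic, `isRotund_of_not_hasIntegerPeriod`). OPEN
for `d ≥ 2` (it contains Mantova–Masser's model system of the open case `(3, 2)`); never asserted.
[cite: MantovaMasser2023, §1 Further remarks] -/
def ECCellAperiodic (d : ℕ) : Prop :=
  ∀ (W : Set (Fin (d + 1) ⊕ Fin (d + 1) → ℂ)), IsIrreducibleClosed ℂ W →
    (W ∩ torusLocus ℂ (d + 1)).Nonempty → IsAddFree ℂ (d + 1) (W ∩ torusLocus ℂ (d + 1)) →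
    IsMulFree ℂ (d + 1) (W ∩ torusLocus ℂ (d + 1)) → zariskiDim ℂ W = (d + 1 : ℕ) →
    addProjDim ℂ (d + 1) W = d → ¬ HasIntegerPeriod ℂ (projAdd '' (W ∩ torusLocus ℂ (d + 1))) →
    (W ∩ expGraph ℂ (d + 1)).Nonempty

/-- **EAC cell `(d + 1, d)`, periodic sub-cell**: `ECCell (d + 1) d` restricted to varieties whose
base `cl π(V)` is a cylinder in a rational direction (has an integer period); here rotundity is a
genuine hypothesis. OPEN for `d ≥ 2`; never asserted. [cite: MantovaMasser2023, §1 Further remarks] -/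
def ECCellPeriodic (d : ℕ) : Prop :=
  ∀ (W : Set (Fin (d + 1) ⊕ Fin (d + 1) → ℂ)), IsIrreducibleClosed ℂ W →
    (W ∩ torusLocus ℂ (d + 1)).Nonempty → IsRotund ℂ (d + 1) (W ∩ torusLocus ℂ (d + 1)) →
    IsAddFree ℂ (d + 1) (W ∩ torusLocus ℂ (d + 1)) → IsMulFree ℂ (d + 1) (W ∩ torusLocus ℂ (d + 1)) →
    zariskiDim ℂ W = (d + 1 : ℕ) → addProjDim ℂ (d + 1) W = d →
    HasIntegerPeriod ℂ (projAdd '' (W ∩ torusLocus ℂ (d + 1))) → (W ∩ expGraph ℂ (d + 1)).Nonempty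

/-- The cell `(d + 1, d)` gives its aperiodic sub-cell (rotundity supplied by
`isRotund_of_not_hasIntegerPeriod`). [folklore] -/
theorem ecCellAperiodic_of_ecCell (h : ECCell (d + 1) d) : ECCellAperiodic d :=
  fun W hW hne hadd hmul hdim hbase haper =>
    h W hW hne (isRotund_of_not_hasIntegerPeriod hW hne hdim hbase haper) hadd hmul hdim hbase

/-- The cell `(d + 1, d)` gives its periodic sub-cell (a restriction). [folklore] -/
theorem ecCellPeriodic_of_ecCell (h : ECCell (d + 1) d) : ECCellPeriodic d :=
  fun W hW hne hrot hadd hmul hdim hbase _ => h W hW hne hrot hadd hmul hdim hbase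

/-- The two sub-cells give back the cell (excluded middle on periodicity of the base). [folklore] -/
theorem ecCell_of_aperiodic_of_periodic (ha : ECCellAperiodic d) (hp : ECCellPeriodic d) :
    ECCell (d + 1) d := by
  intro W hW hne hrot hadd hmul hdim hbase
  by_cases hper : HasIntegerPeriod ℂ (projAdd '' (W ∩ torusLocus ℂ (d + 1)))
  · exact hp W hW hne hrot hadd hmul hdim hbase hper
  · exact ha W hW hne hadd hmul hdim hbase hper

/-- **The cells `(d + 1, d)` split**: `ECCell (d + 1) d ↔ ECCellAperiodic d ∧ ECCellPeriodic d` —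
on aperiodic bases the rotundity hypothesis of Zilber's conjecture is redundant. [folklore] -/
theorem ecCell_succ_iff (d : ℕ) : ECCell (d + 1) d ↔ ECCellAperiodic d ∧ ECCellPeriodic d :=
  ⟨fun h => ⟨ecCellAperiodic_of_ecCell h, ecCellPeriodic_of_ecCell h⟩,
    fun h => ecCell_of_aperiodic_of_periodic h.1 h.2⟩

/-- **The first open rung splits**: `ECCell 3 2 ↔ ECCellAperiodic 2 ∧ ECCellPeriodic 2`. Both
conjuncts are OPEN in print (Mantova–Masser 2024 §1; Aslanyan–Gallinaro 2024 §3.4).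
[cite: MantovaMasser2023, §1 Further remarks] -/
theorem ecCell_three_two_iff : ECCell 3 2 ↔ ECCellAperiodic 2 ∧ ECCellPeriodic 2 :=
  ecCell_succ_iff 2

/-- **The aperiodic sub-cell with MINIMAL hypotheses** (no rotundity, no additive freeness): every
irreducible `W ⊆ ℂⁿ × ℂⁿ` (`n = d + 1`) of dimension `n` with `W ∩ Gⁿ ≠ ∅`, `W ∩ Gⁿ` multiplicatively
free, and additive projection of closure-dimension `d` WITHOUT integer period meets the graph of
`exp`. For `d ≥ 1` this is equivalent to `ECCellAperiodic d` (`ecCellAperiodic_iff_bare`: additive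
freeness is automatic, `isAddFree_of_not_hasIntegerPeriod`, as is rotundity). OPEN for `d ≥ 2`;
never asserted. [cite: MantovaMasser2023, §1 Further remarks] -/
def ECCellAperiodicBare (d : ℕ) : Prop :=
  ∀ (W : Set (Fin (d + 1) ⊕ Fin (d + 1) → ℂ)), IsIrreducibleClosed ℂ W →
    (W ∩ torusLocus ℂ (d + 1)).Nonempty → IsMulFree ℂ (d + 1) (W ∩ torusLocus ℂ (d + 1)) →
    zariskiDim ℂ W = (d + 1 : ℕ) → addProjDim ℂ (d + 1) W = d →
    ¬ HasIntegerPeriod ℂ (projAdd '' (W ∩ torusLocus ℂ (d + 1))) →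
    (W ∩ expGraph ℂ (d + 1)).Nonempty

/-- The bare form gives the sub-cell (drop a hypothesis). [folklore] -/
theorem ecCellAperiodic_of_bare (h : ECCellAperiodicBare d) : ECCellAperiodic d :=
  fun W hW hne _ hmul hdim hbase haper => h W hW hne hmul hdim hbase haper

/-- The sub-cell gives its bare form for `d ≥ 1` (additive freeness supplied by
`isAddFree_of_not_hasIntegerPeriod`). [folklore] -/
theorem ecCellAperiodicBare_of_ecCellAperiodic (hd : 0 < d) (h : ECCellAperiodic d) :
    ECCellAperiodicBare d :=
  fun W hW hne hmul hdim hbase haper =>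
    h W hW hne (isAddFree_of_not_hasIntegerPeriod hW hne hd hbase haper) hmul hdim hbase haper

/-- **`ECCellAperiodic d ↔ ECCellAperiodicBare d`** for `d ≥ 1`. [folklore] -/
theorem ecCellAperiodic_iff_bare (hd : 0 < d) : ECCellAperiodic d ↔ ECCellAperiodicBare d :=
  ⟨ecCellAperiodicBare_of_ecCellAperiodic hd, ecCellAperiodic_of_bare⟩

/-- **The aperiodic half of the first open rung in five hypotheses**: `ECCellAperiodic 2` iff every
irreducible 3-fold `W ⊆ ℂ³ × ℂ³` with `W ∩ G³ ≠ ∅` multiplicatively free, whose additive projection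
has as closure an APERIODIC surface, meets `Γ_exp`. [cite: MantovaMasser2023, §1 Further remarks] -/
theorem ecCellAperiodic_two_iff_bare : ECCellAperiodic 2 ↔ ECCellAperiodicBare 2 :=
  ecCellAperiodic_iff_bare two_pos

/-- **The first open rung, minimal form**: `ECCell 3 2 ↔ ECCellAperiodicBare 2 ∧ ECCellPeriodic 2`.
[cite: MantovaMasser2023, §1 Further remarks] -/
theorem ecCell_three_two_iff_bare : ECCell 3 2 ↔ ECCellAperiodicBare 2 ∧ ECCellPeriodic 2 := by
  rw [ecCell_three_two_iff, ecCellAperiodic_two_iff_bare]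

/-- The general split in bare form: `ECCell (d + 1) d ↔ ECCellAperiodicBare d ∧ ECCellPeriodic d`
(`d ≥ 1`). [folklore] -/
theorem ecCell_succ_iff_bare (hd : 0 < d) :
    ECCell (d + 1) d ↔ ECCellAperiodicBare d ∧ ECCellPeriodic d := by
  rw [ecCell_succ_iff, ecCellAperiodic_iff_bare hd]

/-- **`W ∩ Gⁿ ≠ ∅` is implied by `dim cl π(W ∩ Gⁿ) = d`** (any field, any cell): the empty set has
dimension `⊥`, not a natural number. So the torus-nonemptiness binder of every cell statement is
redundant next to the `addProjDim` binder. [folklore] -/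
theorem inter_torusLocus_nonempty_of_addProjDim_eq {K : Type*} [Field K] {n : ℕ}
    {W : Set (Fin n ⊕ Fin n → K)} {e : ℕ} (h : addProjDim K n W = e) :
    (W ∩ torusLocus K n).Nonempty := by
  by_contra hne
  rw [Set.not_nonempty_iff_eq_empty] at hne
  rw [addProjDim, hne, Set.image_empty, zariskiDim_empty] at h
  exact WithBot.bot_ne_coe (h.trans (WithBot.coe_natCast e).symm)

/-- **The aperiodic sub-cell in FOUR hypotheses**: irreducible of dimension `d + 1`,
multiplicatively free on the torus, additive projection of closure-dimension `d`, aperiodic base.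
[folklore] -/
theorem ecCellAperiodicBare_iff_four :
    ECCellAperiodicBare d ↔
      ∀ (W : Set (Fin (d + 1) ⊕ Fin (d + 1) → ℂ)), IsIrreducibleClosed ℂ W →
        IsMulFree ℂ (d + 1) (W ∩ torusLocus ℂ (d + 1)) → zariskiDim ℂ W = (d + 1 : ℕ) →
        addProjDim ℂ (d + 1) W = d → ¬ HasIntegerPeriod ℂ (projAdd '' (W ∩ torusLocus ℂ (d + 1))) →
        (W ∩ expGraph ℂ (d + 1)).Nonempty :=
  ⟨fun h W hW hmul hdim hbase haper =>
      h W hW (inter_torusLocus_nonempty_of_addProjDim_eq hbase) hmul hdim hbase haper,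
    fun h W hW _ hmul hdim hbase haper => h W hW hmul hdim hbase haper⟩

/-- **The aperiodic half of `EC(3,2)` in four hypotheses.** [cite: MantovaMasser2023, §1 Further remarks] -/
theorem ecCellAperiodic_two_iff_four :
    ECCellAperiodic 2 ↔
      ∀ (W : Set (Fin 3 ⊕ Fin 3 → ℂ)), IsIrreducibleClosed ℂ W →
        IsMulFree ℂ 3 (W ∩ torusLocus ℂ 3) → zariskiDim ℂ W = (3 : ℕ) →
        addProjDim ℂ 3 W = 2 → ¬ HasIntegerPeriod ℂ (projAdd '' (W ∩ torusLocus ℂ 3)) →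
        (W ∩ expGraph ℂ 3).Nonempty := by
  rw [ecCellAperiodic_two_iff_bare]
  exact ecCellAperiodicBare_iff_four

end Cells

/-! ### Two bases in `ℂ³`: Mantova–Masser's quadric is aperiodic, `x₃ = (x₁ - x₂)²` is periodic -/

section Examples

/-- **Mantova–Masser's base**: the quadric `x₃ = x₁² - x₂²` in `ℂ³` (coordinates `0, 1, 2`), the
closure of the additive projection of the model system `e^{x₁} = x₂, e^{x₂} = x₁, e^{x₁² - x₂²} = x₃`
of the open case `(3, 2)` (`Literature.ModelTheory.Zilber.EACRotundityProofs`, `mantovaMasserModel`).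
[cite: MantovaMasser2023, §1 Further remarks] -/
def mmBase : Set (Fin 3 → ℂ) := {x | x 2 = x 0 ^ 2 - x 1 ^ 2}

/-- `mmBase = Z(X₂ - X₀² + X₁²)`. [folklore] -/
theorem mmBase_eq_zeroLocus :
    mmBase = zeroLocus ℂ (Ideal.span {(X 2 - (X 0 ^ 2 - X 1 ^ 2) : MvPolynomial (Fin 3) ℂ)}) := by
  ext x
  rw [mem_zeroLocus_span_singleton_iff]
  simp only [mmBase, Set.mem_setOf_eq, map_sub, map_pow, aeval_X]
  exact ⟨fun h => by rw [h, sub_self], fun h => sub_eq_zero.1 h⟩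

/-- The Mantova–Masser base is Zariski closed. [folklore] -/
theorem isZariskiClosed_mmBase : IsZariskiClosed ℂ mmBase := ⟨_, mmBase_eq_zeroLocus⟩

/-- **The Mantova–Masser base has no integer period**: testing the translate `x + v` at the three
points `0`, `(1, 0, 1)`, `(0, 1, -1)` of the quadric forces `v = 0`. Hence the model system of the
open case lies in the APERIODIC sub-cell `ECCellAperiodic 2`, where rotundity is automatic.
[folklore] -/
theorem not_hasIntegerPeriod_mmBase : ¬ HasIntegerPeriod ℂ mmBase := by
  rw [hasIntegerPeriod_iff_forall_mem_zeroLocus,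
    ← eq_zeroLocus_vanishingIdeal_of_isZariskiClosed isZariskiClosed_mmBase]
  rintro ⟨v, hv, h⟩
  have e0 := h 0 (by simp [mmBase])
  have e1 := h ![1, 0, 1] (by simp [mmBase])
  have e2 := h ![0, 1, -1] (by simp [mmBase])
  simp only [mmBase, Set.mem_setOf_eq, Pi.add_apply, zero_add, Matrix.cons_val_zero,
    Matrix.cons_val_one, Matrix.cons_val_two, Matrix.head_cons, Matrix.tail_cons] at e0 e1 e2
  -- e0 : v₂ = v₀² - v₁²;  e1 : 1 + v₂ = (1 + v₀)² - v₁²;  e2 : -1 + v₂ = v₀² - (1 + v₁)²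
  have f0 : (2 : ℂ) * v 0 = 0 := by linear_combination e0 - e1
  have f1 : (2 : ℂ) * v 1 = 0 := by linear_combination e2 - e0
  have g0 : v 0 = 0 := by exact_mod_cast (mul_eq_zero.1 f0).resolve_left two_ne_zero
  have g1 : v 1 = 0 := by exact_mod_cast (mul_eq_zero.1 f1).resolve_left two_ne_zero
  have g2 : v 2 = 0 := by
    rw [g0, g1] at e0
    have : ((v 2 : ℤ) : ℂ) = 0 := by simpa using e0
    exact_mod_cast this
  apply hv
  funext i
  fin_cases i
  · exact g0
  · exact g1
  · exact g2

/-- **A periodic base**: the cylinder `x₃ = (x₁ - x₂)²` in `ℂ³`, invariant under the integer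
translation `v = (1, 1, 0)`; bases of this shape form the PERIODIC sub-cell `ECCellPeriodic 2`.
[folklore] -/
def diagSquareBase : Set (Fin 3 → ℂ) := {x | x 2 = (x 0 - x 1) ^ 2}

/-- `diagSquareBase = Z(X₂ - (X₀ - X₁)²)`. [folklore] -/
theorem diagSquareBase_eq_zeroLocus :
    diagSquareBase = zeroLocus ℂ (Ideal.span {(X 2 - (X 0 - X 1) ^ 2 : MvPolynomial (Fin 3) ℂ)}) := by
  ext x
  rw [mem_zeroLocus_span_singleton_iff]
  simp only [diagSquareBase, Set.mem_setOf_eq, map_sub, map_pow, aeval_X]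
  exact ⟨fun h => by rw [h, sub_self], fun h => sub_eq_zero.1 h⟩

/-- `diagSquareBase` is Zariski closed. [folklore] -/
theorem isZariskiClosed_diagSquareBase : IsZariskiClosed ℂ diagSquareBase :=
  ⟨_, diagSquareBase_eq_zeroLocus⟩

/-- `x₃ = (x₁ - x₂)²` has the integer period `(1, 1, 0)`. [folklore] -/
theorem hasIntegerPeriod_diagSquareBase : HasIntegerPeriod ℂ diagSquareBase := by
  rw [hasIntegerPeriod_iff_forall_mem_zeroLocus]
  refine ⟨![1, 1, 0], ?_, ?_⟩
  · intro h0
    have := congrFun h0 0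
    simp at this
  · intro x hx
    rw [mem_zeroLocus_vanishingIdeal_iff_of_isZariskiClosed isZariskiClosed_diagSquareBase] at hx ⊢
    simp only [diagSquareBase, Set.mem_setOf_eq, Pi.add_apply, Matrix.cons_val_zero,
      Matrix.cons_val_one, Matrix.cons_val_two, Matrix.head_cons, Matrix.tail_cons,
      Int.cast_one, Int.cast_zero, add_zero] at hx ⊢
    rw [hx]
    ring

end Examples


/-! ### Complex spheres are aperiodic: rotundity over sphere bases is automatic -/

section Sphere

/-- The complex sphere `Σᵢ xᵢ² = r` in `ℂ^{m+2}` — the base of seat 2's sphere family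
(`x₁² + ⋯ + xₙ² = r`, `n ≥ 2`; a cyclic cover `xₙ² = r - Σ_{i<n} xᵢ²`, NOT a graph over a coordinate
hyperplane). [folklore] -/
def sphereBase (m : ℕ) (r : ℂ) : Set (Fin (m + 2) → ℂ) := {x | ∑ i, x i ^ 2 = r}

/-- `sphereBase m r = Z(Σ Xᵢ² - r)`. [folklore] -/
theorem sphereBase_eq_zeroLocus (m : ℕ) (r : ℂ) :
    sphereBase m r = zeroLocus ℂ (Ideal.span {(∑ i, X i ^ 2 - C r : MvPolynomial (Fin (m + 2)) ℂ)}) := by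
  ext x
  simp only [sphereBase, Set.mem_setOf_eq, mem_zeroLocus_span_singleton_iff, map_sub, map_sum,
    map_pow, aeval_X, aeval_C, Algebra.algebraMap_self_apply, sub_eq_zero]

/-- Spheres are Zariski closed. [folklore] -/
theorem isZariskiClosed_sphereBase (m : ℕ) (r : ℂ) : IsZariskiClosed ℂ (sphereBase m r) :=
  ⟨_, sphereBase_eq_zeroLocus m r⟩

/-- An explicit point `((r+1)/2, i(r-1)/2, 0, …, 0)` of the sphere (no square roots needed).
[folklore] -/
theorem spherePt_mem_sphereBase (m : ℕ) (r : ℂ) :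
    (Fin.cons ((r + 1) / 2) (Fin.cons (Complex.I * (r - 1) / 2) 0) : Fin (m + 2) → ℂ) ∈
      sphereBase m r := by
  simp only [sphereBase, Set.mem_setOf_eq, Fin.sum_univ_succ, Fin.cons_succ, Fin.cons_zero,
    Pi.zero_apply]
  simp only [ne_eq, OfNat.ofNat_ne_zero, not_false_eq_true, zero_pow, Finset.sum_const_zero,
    add_zero]
  linear_combination ((r - 1) ^ 2 / 4) * Complex.I_sq

/-- Spheres are symmetric under `x ↦ -x`. [folklore] -/
theorem neg_mem_sphereBase {m : ℕ} {r : ℂ} {x : Fin (m + 2) → ℂ} (hx : x ∈ sphereBase m r) :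
    -x ∈ sphereBase m r := by
  simp only [sphereBase, Set.mem_setOf_eq, Pi.neg_apply, neg_sq] at hx ⊢
  exact hx

/-- **Complex spheres have no integer translation period** (any `r`, any dimension `≥ 2`): if
`S + v ⊆ S` then applying it to `x` and `-x` gives `Σ vᵢ² = 0`, impossible for `v ∈ ℤⁿ ∖ 0`.
Hence (`isRotund_of_not_hasIntegerPeriod`, `isAddFree_of_not_hasIntegerPeriod`) every irreducible
`n`-fold `V ⊆ ℂⁿ × (ℂ*)ⁿ` of dimension `n` whose additive projection has closure a sphere is
automatically ROTUND and ADDITIVELY FREE. [folklore] -/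
theorem not_hasIntegerPeriod_sphereBase (m : ℕ) (r : ℂ) : ¬ HasIntegerPeriod ℂ (sphereBase m r) := by
  rw [hasIntegerPeriod_iff_forall_mem_zeroLocus]
  rintro ⟨v, hv, h⟩
  simp only [mem_zeroLocus_vanishingIdeal_iff_of_isZariskiClosed (isZariskiClosed_sphereBase m r)]
    at h
  set p : Fin (m + 2) → ℂ := Fin.cons ((r + 1) / 2) (Fin.cons (Complex.I * (r - 1) / 2) 0) with hpdef
  have hp : p ∈ sphereBase m r := spherePt_mem_sphereBase m r
  have h1 := h p hp
  have h2 := h (-p) (neg_mem_sphereBase hp)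
  simp only [sphereBase, Set.mem_setOf_eq, Pi.add_apply, Pi.neg_apply] at h1 h2 hp
  have key : ∑ i, ((v i : ℂ)) ^ 2 = 0 := by
    have e1 : ∑ i, (p i + (v i : ℂ)) ^ 2 + ∑ i, (-p i + (v i : ℂ)) ^ 2
        = 2 * ∑ i, p i ^ 2 + 2 * ∑ i, ((v i : ℂ)) ^ 2 := by
      rw [← Finset.sum_add_distrib, Finset.mul_sum, Finset.mul_sum, ← Finset.sum_add_distrib]
      exact Finset.sum_congr rfl fun i _ => by ring
    rw [h1, h2, hp] at e1
    linear_combination (-1 / 2 : ℂ) * e1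
  have hz : ∑ i, v i ^ 2 = (0 : ℤ) := by exact_mod_cast key
  have hvi : ∀ i, v i = 0 := by
    intro i
    have hi := (Finset.sum_eq_zero_iff_of_nonneg fun j _ => sq_nonneg (v j)).1 hz i
      (Finset.mem_univ i)
    exact (pow_eq_zero_iff two_ne_zero).1 hi
  exact hv (funext hvi)

end Sphere

end Literature.ModelTheory.Zilber
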